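import Summits.Langlands.Langlands.Theses.HeckeFieldDeRham
import Summits.Langlands.Langlands.Theorems.IrreducibilityBySelfDualityReciprocityUpToIrreducibilityCorrespondsConj

/-!
# Converse certificates: every leaf of the RMD decomposition is a CONSEQUENCE of the (re-typed) summit,
# and the support leaf `AvatarConjugacy` IS a landed theorem.

`Langlands → W⁺`, `Langlands → B_w`, `Langlands → LGC°` (weak-to-strong upgrade `corresponds_of_exists_corresponds`,
p119850), `AvatarConjugacy` outright (`isConjugate_of_satakeFrobCompatibleAt`).  So no leaf is more false than the
summit; and since `Langlands → ReciprocityModuloDeRham` (refuter, RMDProbes.lean) the partition is CONSISTENT.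
-/

set_option linter.dupNamespace false

namespace Summit.Langlands.Langlands.Theses.HeckeFieldDeRham

open scoped BigOperators Topology Manifold Classical MeasureTheory ProbabilityTheory Matrix InnerProductSpace ComplexConjugate ContinuousMap
open Filter Set Function TopologicalSpace MeasureTheory

def SatakeAvatarExistence : Prop :=
  ∀ (K : Type) [Field K] [NumberField K] (n : ℕ) (hcpt : Literature.NumberTheory.Automorphic.isCompact_glFiniteIntegralLevel n K), 0 < n → ∀ (π : Literature.NumberTheory.Automorphic.CuspidalAutomorphicRepData n K hcpt), π.1.IsLAlgebraic → ∀ (ℓ : ℕ) [Fact ℓ.Prime] (ι : PadicAlgCl ℓ ≃+* ℂ), ∃ ρ : Literature.NumberTheory.GaloisRepresentations.FramedGaloisRep K (PadicAlgCl ℓ) n, ρ.toGaloisRep.IsIrreducible ∧ ∀ᶠ v : IsDedekindDomain.HeightOneSpectrum (NumberField.RingOfIntegers K) in cofinite, SatakeFrobCompatibleAt ι π.1 ρ v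

def WeakGeometricAutomorphy : Prop :=
  ∀ (K : Type) [Field K] [NumberField K] (n : ℕ) (hcpt : Literature.NumberTheory.Automorphic.isCompact_glFiniteIntegralLevel n K), 0 < n → ∀ (ℓ : ℕ) [Fact ℓ.Prime] (ι : PadicAlgCl ℓ ≃+* ℂ) (ρ : Literature.NumberTheory.GaloisRepresentations.FramedGaloisRep K (PadicAlgCl ℓ) n), ρ.toGaloisRep.IsIrreducible → ((∀ᶠ v : IsDedekindDomain.HeightOneSpectrum (NumberField.RingOfIntegers K) in cofinite, ρ.IsUnramifiedAt v) ∧ ∀ (v : IsDedekindDomain.HeightOneSpectrum (NumberField.RingOfIntegers K)) (hv : ((ℓ : ℕ) : NumberField.RingOfIntegers K) ∈ v.asIdeal), (Literature.NumberTheory.PAdicHodge.fontainePstAdicCompletion v ℓ hv).IsDeRhamFramed (ρ.toLocal v)) → ∃ π : Literature.NumberTheory.Automorphic.CuspidalAutomorphicRepData n K hcpt, π.1.IsLAlgebraic ∧ ∀ᶠ v : IsDedekindDomain.HeightOneSpectrum (NumberField.RingOfIntegers K) in cofinite, SatakeFrobCompatibleAt ι π.1 ρ v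

def PairCompatibilityModuloDeRham : Prop :=
  ∀ (K : Type) [Field K] [NumberField K], ∃ Rec : ReciprocityData K, ∀ (n : ℕ) (hcpt : Literature.NumberTheory.Automorphic.isCompact_glFiniteIntegralLevel n K), 0 < n → ∀ (π : Literature.NumberTheory.Automorphic.CuspidalAutomorphicRepData n K hcpt), π.1.IsLAlgebraic → ∀ (ℓ : ℕ) [Fact ℓ.Prime] (ι : PadicAlgCl ℓ ≃+* ℂ) (ρ : Literature.NumberTheory.GaloisRepresentations.FramedGaloisRep K (PadicAlgCl ℓ) n), ρ.toGaloisRep.IsIrreducible → (∀ᶠ v : IsDedekindDomain.HeightOneSpectrum (NumberField.RingOfIntegers K) in cofinite, SatakeFrobCompatibleAt ι π.1 ρ v) → ∀ v : IsDedekindDomain.HeightOneSpectrum (NumberField.RingOfIntegers K), (∀ hv : ((ℓ : ℕ) : NumberField.RingOfIntegers K) ∈ v.asIdeal, (Rec.pst ℓ v hv).IsDeRhamFramed (ρ.toLocal v)) → LocalGlobalCompatibleAt Rec ι π.1 ρ v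

def AvatarConjugacy : Prop :=
  ∀ (K : Type) [Field K] [NumberField K] (n : ℕ) (hcpt : Literature.NumberTheory.Automorphic.isCompact_glFiniteIntegralLevel n K) (π : Literature.NumberTheory.Automorphic.CuspidalAutomorphicRepData n K hcpt) (ℓ : ℕ) [Fact ℓ.Prime] (ι : PadicAlgCl ℓ ≃+* ℂ) (ρ₀ ρ : Literature.NumberTheory.GaloisRepresentations.FramedGaloisRep K (PadicAlgCl ℓ) n), ρ₀.toGaloisRep.IsIrreducible → (∀ᶠ v : IsDedekindDomain.HeightOneSpectrum (NumberField.RingOfIntegers K) in cofinite, SatakeFrobCompatibleAt ι π.1 ρ₀ v) → (∀ᶠ v : IsDedekindDomain.HeightOneSpectrum (NumberField.RingOfIntegers K) in cofinite, SatakeFrobCompatibleAt ι π.1 ρ v) → IsConjugate ρ₀ ρ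

/-- The support leaf IS a theorem of the tree (Chebotarev + Brauer–Nesbitt, p119850). -/
theorem avatarConjugacy_holds : AvatarConjugacy :=
  fun _K _ _ _n _hcpt π _ℓ _ ι _ρ₀ _ρ hirr h₀ h =>
    Theorems.ReciprocityUpToIrreducibility.isConjugate_of_satakeFrobCompatibleAt π.1 ι hirr h₀ h

/-- `Langlands → W⁺` (projection of (A); `Rec` from the non-vacuity conjunct). -/
theorem satakeAvatarExistence_of_langlands (hL : _root_.Langlands) : SatakeAvatarExistence := by
  intro K _ _ n hcpt hn π hπ ℓ _ ι
  obtain ⟨⟨Rec⟩, h⟩ := hL K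
  obtain ⟨ρ, hirr, -, hcorr, -⟩ := (h Rec n hn hcpt).1 π hπ ℓ ι
  exact ⟨ρ, hirr, hcorr.1⟩

/-- `Langlands → B_w` (projection of (B); `Rec.pst` is the pinned Fontaine datum by `rfl`). -/
theorem weakGeometricAutomorphy_of_langlands (hL : _root_.Langlands) : WeakGeometricAutomorphy := by
  intro K _ _ n hcpt hn ℓ _ ι ρ hirr hgeo
  obtain ⟨⟨Rec⟩, h⟩ := hL K
  obtain ⟨π, hπ, hcorr⟩ := (h Rec n hn hcpt).2 ℓ ι ρ hirr ⟨hgeo.1, fun v hv => hgeo.2 v hv⟩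
  exact ⟨π, hπ, hcorr.1⟩

/-- `Langlands → LGC°` (for ANY datum: (A) gives a corresponding `ρ'`, the weak-to-strong upgrade transfers
`Corresponds` to every irreducible Satake-compatible `ρ`; the de Rham hypothesis is not even needed). -/
theorem pairCompatibilityModuloDeRham_of_langlands (hL : _root_.Langlands) : PairCompatibilityModuloDeRham := by
  intro K _ _
  obtain ⟨⟨Rec⟩, h⟩ := hL K
  refine ⟨Rec, fun n hcpt hn π hπ ℓ _ ι ρ hirr hsat v _ => ?_⟩
  obtain ⟨ρ', -, -, hcorr', -⟩ := (h Rec n hn hcpt).1 π hπ ℓ ι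
  exact (Theorems.ReciprocityUpToIrreducibility.corresponds_of_exists_corresponds hirr hsat ⟨ρ', hcorr'⟩).2 v

/-- Stronger: `Langlands` gives LGC° for EVERY datum (the `∀ Rec` form the re-typed summit will want). -/
theorem pairCompatibilityModuloDeRham_forall_of_langlands (hL : _root_.Langlands) :
    ∀ (K : Type) [Field K] [NumberField K] (Rec : ReciprocityData K) (n : ℕ) (hcpt : Literature.NumberTheory.Automorphic.isCompact_glFiniteIntegralLevel n K), 0 < n → ∀ (π : Literature.NumberTheory.Automorphic.CuspidalAutomorphicRepData n K hcpt), π.1.IsLAlgebraic → ∀ (ℓ : ℕ) [Fact ℓ.Prime] (ι : PadicAlgCl ℓ ≃+* ℂ) (ρ : Literature.NumberTheory.GaloisRepresentations.FramedGaloisRep K (PadicAlgCl ℓ) n), ρ.toGaloisRep.IsIrreducible → (∀ᶠ v : IsDedekindDomain.HeightOneSpectrum (NumberField.RingOfIntegers K) in cofinite, SatakeFrobCompatibleAt ι π.1 ρ v) → ∀ v : IsDedekindDomain.HeightOneSpectrum (NumberField.RingOfIntegers K), LocalGlobalCompatibleAt Rec ι π.1 ρ v := by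
  intro K _ _ Rec n hcpt hn π hπ ℓ _ ι ρ hirr hsat v
  obtain ⟨-, h⟩ := hL K
  obtain ⟨ρ', -, -, hcorr', -⟩ := (h Rec n hn hcpt).1 π hπ ℓ ι
  exact (Theorems.ReciprocityUpToIrreducibility.corresponds_of_exists_corresponds hirr hsat ⟨ρ', hcorr'⟩).2 v

end Summit.Langlands.Langlands.Theses.HeckeFieldDeRham
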